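import Summits.CriticalPhenomena.SAWScalingLimit.Theses.SAWLeftRightFKG
import Literature.Probability.RandomPlanarGeometry.SelfAvoidingWalkProofs
import Literature.Probability.RandomPlanarGeometry.SAWSideProbability
import Literature.Probability.Percolation.CLE6Proofs

/-!
# Negative-side lemmas for the crux `SAWLeftRightFKG.FKGToTraversalBound` (stmt-CriticalPhenomena-1878):
logic of the glue, the two-maximal-chords obstruction to left–right positive association, and
"no floating holes" for the domains of the hypothesis `LeftRightFKG`

Refuter `cdisprove` (standing adversary, cycle 1); the indexed work file is
`Summits/CriticalPhenomena/SAWScalingLimit/Cruxes/FKGToTraversalBound/Disproof.lean`.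

* §1 `¬ FKGToTraversalBound ↔ LeftRightFKG ∧ ¬ SAWTraversalBound`: a disproof of the crux is a proof of
  the rank-2 crux plus a disproof of the Aizenman–Burchard hypothesis (H1).
* §2 The PA clause of `LeftRightFKG` for one carrier (`PAClause`, definitionally the crux's own clause,
  `leftRightFKG_iff_PAClause`) is FALSE as soon as the left–right poset has two distinct maximal chords
  (`not_PAClause_weight_of_two_maximal`; `A = {m₁}`, `B = {m₂}` are up-closed and every chord has weight
  `x_c^{|γ|} > 0`).  Exact enumeration (work file F3; `job1/lrposet.py`, order = height-vector dominance)
  finds 7 / 6 / 4 / 3 maximal chords on 5×5 boxes as soon as BOTH endpoints are interior — the regime of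
  deep endpoint approximations, which `IsEndpointApprox` admits (sibling
  `TPToTraversalBound.Negative.exists_isEndpointApprox_deepStart`) and where `LeftRightFKG` (both endpoints
  boundary-adjacent) cannot be instantiated; the adjacency-free PA `LeftRightFKGFree` is false modulo the
  finite winding computation `TwoMaxFree` (`not_leftRightFKGFree_of_twoMax`).
* §3 `noFloatingHoles`: every vertex of the boundary walk `C` is joined, through lattice sites OUTSIDE the
  domain `{z | wind(C, z) ≠ 0}`, to a site strictly to the right of `C` — so the punctured lattice domain
  `Ω_δ ∖ {a_δ}` produced by "conditioning on the first step" of a SAW started at a deep `a_δ` is not the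
  site set of any `LeftRightFKG` domain whose boundary walk passes through `a_δ`
  (`not_presentable_of_enclosed`).
-/

noncomputable section

namespace Summit.CriticalPhenomena.SAWScalingLimit.Theorems.FKGToTraversalBound.Negative

open Summit.CriticalPhenomena.SAWScalingLimit.Theses.SAWLeftRightFKG
open Literature.Probability.RandomPlanarGeometry Literature.Probability.LatticeModels MeasureTheory
open Literature.Topology.PlaneTopology Set

/-! ## §1 Logic of the glue -/

/-- The crux is literally the implication `LeftRightFKG → SAWTraversalBound`. [folklore] -/
theorem iff_imp : FKGToTraversalBound ↔ (LeftRightFKG → SAWTraversalBound) := Iff.rfl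

/-- A disproof of the crux is EXACTLY a proof of left–right PA together with a disproof of (H1). [folklore] -/
theorem not_crux_iff : ¬ FKGToTraversalBound ↔ LeftRightFKG ∧ ¬ SAWTraversalBound :=
  Classical.not_imp

/-- The crux as a disjunction: it holds iff PA fails or (H1) holds. [folklore] -/
theorem crux_iff_or : FKGToTraversalBound ↔ (¬ LeftRightFKG ∨ SAWTraversalBound) := imp_iff_not_or

/-! ## §2 The PA clause; two maximal chords kill it at every fugacity -/

/-- The positive-association clause of `LeftRightFKG` for ONE carrier: for all `le`-up-closed `A, B`,
`w(A) w(B) ≤ w(univ) w(A ∩ B)`. -/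
def PAClause {ι : Type*} [MeasurableSpace ι] (le : ι → ι → Prop) (w : Measure ι) : Prop :=
  ∀ A B : Set ι, (∀ γ₁ γ₂, le γ₁ γ₂ → γ₁ ∈ A → γ₂ ∈ A) → (∀ γ₁ γ₂, le γ₁ γ₂ → γ₁ ∈ B → γ₂ ∈ B) →
    w A * w B ≤ w Set.univ * w (A ∩ B)

/-- The crux's domain `Ω(C, δ) = {z | wind(δ-polyline of C, z) ≠ 0}` — verbatim the `let Ω` of
`LeftRightFKG`. -/
def dom {c : Site 2} (C : (zdGraph 2).Walk c c) (δ : ℝ) : Set ℂ :=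
  {z | Literature.Topology.PlaneTopology.wind
    (fun t : ℝ => Set.IccExtend zero_le_one (C.toCurve (meshPoint δ)) t - z) ≠ 0}

/-- The crux's left–right order — verbatim the `let le` of `LeftRightFKG`: the lens loop `γ₁ · γ₂⁻¹`
has winding number `≥ 0` about every point. -/
def lrLE {Ω : Set ℂ} {δ : ℝ} {a b : Site 2} (γ₁ γ₂ : SAW.DomainSAW Ω δ a b) : Prop :=
  ∀ z : ℂ, 0 ≤ Literature.Topology.PlaneTopology.wind (fun t : ℝ =>
    Set.IccExtend zero_le_one ((γ₁.walk.append γ₂.walk.reverse).toCurve (meshPoint δ)) t - z)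

/-- `LeftRightFKG` is the PA clause for every admissible `(δ, C, a, b)` (definitional). [folklore] -/
theorem leftRightFKG_iff_PAClause :
    LeftRightFKG ↔ ∀ (δ : ℝ) (c a b a' b' : Site 2) (C : (zdGraph 2).Walk c c), 0 < δ →
      a' ∈ C.support → b' ∈ C.support → (zdGraph 2).Adj a a' → (zdGraph 2).Adj b b' →
        PAClause (lrLE (Ω := dom C δ) (δ := δ) (a := a) (b := b)) (SAW.weight (dom C δ) δ a b) :=
  Iff.rfl

/-- **Two distinct maximal elements kill the PA clause** for any measure charging both: `A = {m₁}` and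
`B = {m₂}` are up-closed and `w{m₁}·w{m₂} ≤ w(univ)·w(∅) = 0` is false. [folklore] -/
theorem not_PAClause_of_two_maximal {ι : Type*} [MeasurableSpace ι] {le : ι → ι → Prop} {w : Measure ι}
    {m₁ m₂ : ι} (hne : m₁ ≠ m₂) (h₁ : ∀ γ, le m₁ γ → γ = m₁) (h₂ : ∀ γ, le m₂ γ → γ = m₂)
    (hw₁ : w {m₁} ≠ 0) (hw₂ : w {m₂} ≠ 0) : ¬ PAClause le w := by
  intro h
  have hA : ∀ γ₁ γ₂, le γ₁ γ₂ → γ₁ ∈ ({m₁} : Set ι) → γ₂ ∈ ({m₁} : Set ι) := by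
    intro γ₁ γ₂ hle hγ₁
    rw [Set.mem_singleton_iff] at hγ₁ ⊢
    subst hγ₁
    exact h₁ _ hle
  have hB : ∀ γ₁ γ₂, le γ₁ γ₂ → γ₁ ∈ ({m₂} : Set ι) → γ₂ ∈ ({m₂} : Set ι) := by
    intro γ₁ γ₂ hle hγ₁
    rw [Set.mem_singleton_iff] at hγ₁ ⊢
    subst hγ₁
    exact h₂ _ hle
  have key := h {m₁} {m₂} hA hB
  have hint : ({m₁} : Set ι) ∩ {m₂} = ∅ := by
    rw [Set.singleton_inter_eq_empty, Set.mem_singleton_iff]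
    exact hne
  rw [hint, measure_empty, mul_zero, nonpos_iff_eq_zero, mul_eq_zero] at key
  exact key.elim hw₁ hw₂

/-- Every single chord has nonzero critical weight `x_c^{|γ|}` (`0 < x_c`, proved in tree). [folklore] -/
theorem weight_singleton_ne_zero {Ω : Set ℂ} {δ : ℝ} {a b : Site 2} (γ : SAW.DomainSAW Ω δ a b) :
    SAW.weight Ω δ a b {γ} ≠ 0 := by
  rw [SAW.weight_singleton]
  exact (ENNReal.ofReal_pos.2 (pow_pos SAW.criticalFugacity_pos_lt_one'.1 _)).ne'

/-- On the crux's own carrier: two distinct `≼`-maximal chords refute the PA clause for that `(Ω, a, b)`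
at the critical fugacity (and, verbatim, at every positive fugacity). [folklore] -/
theorem not_PAClause_weight_of_two_maximal {Ω : Set ℂ} {δ : ℝ} {a b : Site 2}
    {m₁ m₂ : SAW.DomainSAW Ω δ a b} (hne : m₁ ≠ m₂)
    (h₁ : ∀ γ, lrLE m₁ γ → γ = m₁) (h₂ : ∀ γ, lrLE m₂ γ → γ = m₂) :
    ¬ PAClause (lrLE (Ω := Ω) (δ := δ) (a := a) (b := b)) (SAW.weight Ω δ a b) :=
  not_PAClause_of_two_maximal hne h₁ h₂ (weight_singleton_ne_zero m₁) (weight_singleton_ne_zero m₂)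

/-- PA with the boundary-adjacency of BOTH endpoints dropped — what the one-curve RSW scheme would need at
time zero for an endpoint approximation with deep start and deep target. -/
def LeftRightFKGFree : Prop :=
  ∀ (δ : ℝ) (c a b : Site 2) (C : (zdGraph 2).Walk c c), 0 < δ →
    PAClause (lrLE (Ω := dom C δ) (δ := δ) (a := a) (b := b)) (SAW.weight (dom C δ) δ a b)

/-- PA with the adjacency of the TARGET only dropped — what the scheme needs after conditioning on a
past (tip adjacent to the past) when the target `b_δ` is deep. -/
def LeftRightFKGFreeTarget : Prop :=
  ∀ (δ : ℝ) (c a b a' : Site 2) (C : (zdGraph 2).Walk c c), 0 < δ → a' ∈ C.support →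
    (zdGraph 2).Adj a a' →
      PAClause (lrLE (Ω := dom C δ) (δ := δ) (a := a) (b := b)) (SAW.weight (dom C δ) δ a b)

/-- The free form implies the target-free form. [folklore] -/
theorem freeTarget_of_free (h : LeftRightFKGFree) : LeftRightFKGFreeTarget :=
  fun δ c a b _ C hδ _ _ => h δ c a b C hδ

/-- The finite witness that kills `LeftRightFKGFree`: an admissible carrier with two distinct maximal
chords.  Computed instances (exact enumeration, work file F3): the 5×5 box with a=(2,2), b=(3,3) has 7
maximal and 7 minimal chords among 3762; a=(1,1), b=(3,3): 6/6; the punctured box 5×5∖{(1,1)} with tip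
a=(2,1) and deep target b=(3,3): 4/3 among 1065. -/
def TwoMaxFree : Prop :=
  ∃ (δ : ℝ) (c a b : Site 2) (C : (zdGraph 2).Walk c c) (m₁ m₂ : SAW.DomainSAW (dom C δ) δ a b),
    0 < δ ∧ m₁ ≠ m₂ ∧ (∀ γ, lrLE m₁ γ → γ = m₁) ∧ (∀ γ, lrLE m₂ γ → γ = m₂)

/-- Modulo the finite winding computation `TwoMaxFree`, the adjacency-free PA is FALSE (at every
fugacity): the scheme has no positively associated object for deep–deep endpoint approximations. [folklore] -/
theorem not_leftRightFKGFree_of_twoMax (h : TwoMaxFree) : ¬ LeftRightFKGFree := by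
  rintro hfree
  obtain ⟨δ, c, a, b, C, m₁, m₂, hδ, hne, h₁, h₂⟩ := h
  exact not_PAClause_weight_of_two_maximal hne h₁ h₂ (hfree δ c a b C hδ)

/-! ## §3 No floating holes in the domains of `LeftRightFKG` -/

/-- `wind` takes the junk value `0` when no continuous logarithm exists. [folklore] -/
theorem wind_eq_zero_of_not_hasLogOn {f : ℝ → ℂ} (h : ¬ HasLogOn f (Icc 0 1)) : wind f = 0 := by
  rw [wind, dif_neg (fun h' => h h'.1)]

/-- A loop through `z` has winding (junk) `0` about `z`. [folklore] -/
theorem wind_sub_eq_zero_of_mem_range {γ : C(unitInterval, ℂ)} {z : ℂ} (hz : z ∈ Set.range γ) :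
    wind (fun t : ℝ => Set.IccExtend zero_le_one γ t - z) = 0 := by
  apply wind_eq_zero_of_not_hasLogOn
  intro h
  obtain ⟨t, ht⟩ := hz
  have := h.ne_zero (x := (t : ℝ)) ⟨t.2.1, t.2.2⟩
  apply this
  simp only [Set.IccExtend_val, ht, sub_self]

/-- A loop confined to the closed half-plane `{re ≤ M}` does not wind about a point with `re > M`
(`w ↦ w − z` has the continuous logarithm `log (z − w) + iπ` there). [folklore] -/
theorem wind_sub_eq_zero_of_re_le {γ : C(unitInterval, ℂ)} {M : ℝ} (hγ : ∀ s, (γ s).re ≤ M)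
    {z : ℂ} (hz : M < z.re) (h01 : γ 0 = γ 1) :
    wind (fun t : ℝ => Set.IccExtend zero_le_one γ t - z) = 0 := by
  have hF : HasLogOn (fun w : ℂ => w - z) {w : ℂ | w.re ≤ M} := by
    refine ⟨fun w => Complex.log (z - w) + Real.pi * Complex.I, ?_, ?_⟩
    · refine ContinuousOn.add ?_ continuousOn_const
      refine (ContinuousOn.sub continuousOn_const continuousOn_id).clog ?_
      intro w hw
      have hw' : w.re ≤ M := hw
      rw [Complex.mem_slitPlane_iff]
      left
      simp
      linarith
    · intro w hw
      have hw' : w.re ≤ M := hw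
      have hne : z - w ≠ 0 := by
        intro h0
        have := congrArg Complex.re h0
        simp only [Complex.sub_re, Complex.zero_re] at this
        linarith
      rw [Complex.exp_add, Complex.exp_log hne, Complex.exp_pi_mul_I]
      ring
  have hcont : Continuous fun t : ℝ => Set.IccExtend zero_le_one γ t := γ.continuous.Icc_extend'
  have := wind_comp_eq_zero_of_hasLogOn (γ := fun t : ℝ => Set.IccExtend zero_le_one γ t) hF
    hcont.continuousOn ?_ ?_
  · exact this
  · intro t ht
    show (Set.IccExtend zero_le_one γ t).re ≤ M
    rw [Set.IccExtend_of_mem _ _ ht]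
    exact hγ _
  · show Set.IccExtend zero_le_one γ 0 = Set.IccExtend zero_le_one γ 1
    rw [Set.IccExtend_left, Set.IccExtend_right]
    exact h01

/-- The vertices of the boundary walk are NOT sites of the domain (they lie on the trace, where `wind` is
the junk `0`). [folklore] -/
theorem notMem_dom_of_mem_support {c : Site 2} (C : (zdGraph 2).Walk c c) (δ : ℝ) {x : Site 2}
    (hx : x ∈ C.support) : meshPoint δ x ∉ dom C δ := by
  simp only [dom, Set.mem_setOf_eq, not_not]
  exact wind_sub_eq_zero_of_mem_range (C.mem_range_toCurve (meshPoint δ) hx)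

/-- A site strictly to the right of every vertex of the boundary walk is NOT a site of the domain. [folklore] -/
theorem notMem_dom_of_forall_lt {c : Site 2} (C : (zdGraph 2).Walk c c) {δ : ℝ} (hδ : 0 < δ)
    {y : Site 2} (hy : ∀ x ∈ C.support, x 0 < y 0) : meshPoint δ y ∉ dom C δ := by
  simp only [dom, Set.mem_setOf_eq, not_not]
  have hsub : Set.range (C.toCurve (meshPoint δ)) ⊆ {w : ℂ | w.re ≤ δ * ((y 0 : ℝ) - 1)} := by
    refine SimpleGraph.Walk.range_toCurve_subset C ?_ ?_
    · show (meshPoint δ c).re ≤ δ * ((y 0 : ℝ) - 1)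
      rw [meshPoint_re]
      have := hy c C.start_mem_support
      have : (c 0 : ℝ) ≤ (y 0 : ℝ) - 1 := by exact_mod_cast Int.le_sub_one_of_lt this
      exact mul_le_mul_of_nonneg_left this hδ.le
    · intro d hd
      refine (convex_halfSpace_re_le _).segment_subset ?_ ?_
      · show (meshPoint δ d.fst).re ≤ δ * ((y 0 : ℝ) - 1)
        rw [meshPoint_re]
        have := hy _ (C.dart_fst_mem_support_of_mem_darts hd)
        have : (d.fst 0 : ℝ) ≤ (y 0 : ℝ) - 1 := by exact_mod_cast Int.le_sub_one_of_lt this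
        exact mul_le_mul_of_nonneg_left this hδ.le
      · show (meshPoint δ d.snd).re ≤ δ * ((y 0 : ℝ) - 1)
        rw [meshPoint_re]
        have := hy _ (C.dart_snd_mem_support_of_mem_darts hd)
        have : (d.snd 0 : ℝ) ≤ (y 0 : ℝ) - 1 := by exact_mod_cast Int.le_sub_one_of_lt this
        exact mul_le_mul_of_nonneg_left this hδ.le
  refine wind_sub_eq_zero_of_re_le (M := δ * ((y 0 : ℝ) - 1)) (fun s => hsub ⟨s, rfl⟩) ?_ ?_
  · rw [meshPoint_re]
    nlinarith
  · rw [SimpleGraph.Walk.toCurve_apply_zero, SimpleGraph.Walk.toCurve_apply_one]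

/-- **No floating holes.**  Every vertex `v` of the boundary walk `C` is joined by a lattice walk whose
vertices all lie OUTSIDE the domain `{x | δx ∈ Ω(C, δ)}` to a site strictly to the right of every vertex of
`C` (follow `C` to its vertex of maximal abscissa, then one step east).  Hence the complement of an r2
lattice domain is connected "to infinity" through the trace: the components of `{wind ≠ 0}` enclose no
lattice site that is not theirs. [folklore] -/
theorem noFloatingHoles {c : Site 2} (C : (zdGraph 2).Walk c c) {δ : ℝ} (hδ : 0 < δ)
    {v : Site 2} (hv : v ∈ C.support) :
    ∃ (u : Site 2) (p : (zdGraph 2).Walk v u), (∀ x ∈ C.support, x 0 < u 0) ∧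
      ∀ x ∈ p.support, meshPoint δ x ∉ dom C δ := by
  classical
  obtain ⟨E, hE, hEmax⟩ := C.support.toFinset.exists_max_image (fun x : Site 2 => x 0)
    ⟨c, List.mem_toFinset.2 C.start_mem_support⟩
  have hE' : E ∈ C.support := List.mem_toFinset.1 hE
  set u : Site 2 := E + Pi.single 0 1 with hu
  have hadj : (zdGraph 2).Adj E u := (zdGraph_adj_iff _ _).2 ⟨0, Or.inl rfl⟩
  have hu0 : u 0 = E 0 + 1 := by simp [hu]
  have hlt : ∀ x ∈ C.support, x 0 < u 0 := by
    intro x hx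
    have := hEmax x (List.mem_toFinset.2 hx)
    omega
  let q : (zdGraph 2).Walk v E := (C.takeUntil v hv).reverse.append (C.takeUntil E hE')
  have hq : ∀ x ∈ q.support, x ∈ C.support := by
    intro x hx
    rw [SimpleGraph.Walk.support_append, List.mem_append, SimpleGraph.Walk.support_reverse,
      List.mem_reverse] at hx
    rcases hx with hx | hx
    · exact C.support_takeUntil_subset_support hv hx
    · exact C.support_takeUntil_subset_support hE' (List.tail_subset _ hx)
  refine ⟨u, q.append (SimpleGraph.Walk.cons hadj SimpleGraph.Walk.nil), hlt, ?_⟩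
  intro x hx
  rw [SimpleGraph.Walk.support_append, List.mem_append] at hx
  rcases hx with hx | hx
  · exact notMem_dom_of_mem_support C δ (hq x hx)
  · simp only [SimpleGraph.Walk.support_cons, SimpleGraph.Walk.support_nil, List.tail_cons,
      List.mem_singleton] at hx
    subst hx
    exact notMem_dom_of_forall_lt C hδ hlt

/-- **The first-step device cannot present a punctured domain.**  If all four lattice neighbours of a
vertex `v` of the boundary walk `C` are sites of the domain, contradiction: so a lattice site set `S` in
which some `v` is ENCLOSED (every `ℤ²`-neighbour of `v` lies in `S`) is never the site set of an r2 domain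
whose boundary walk passes through `v`.  Applied to `S = Ω_δ ∖ {a_δ}` (deep start `a_δ`, tip adjacent to
`a' = a_δ ∈ C.support` as the scheme proposes): `LeftRightFKG` is not instantiable there. [folklore] -/
theorem not_presentable_of_enclosed {c : Site 2} (C : (zdGraph 2).Walk c c) {δ : ℝ} (hδ : 0 < δ)
    {v : Site 2} (hv : v ∈ C.support) {S : Set (Site 2)} (hS : ∀ w, (zdGraph 2).Adj v w → w ∈ S) :
    S ≠ {x | meshPoint δ x ∈ dom C δ} := by
  intro hSeq
  obtain ⟨u, p, hlt, hp⟩ := noFloatingHoles C hδ hv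
  have huv : v ≠ u := by
    intro h
    have := hlt v hv
    rw [h] at this
    exact lt_irrefl _ this
  cases p with
  | nil => exact huv rfl
  | cons hadj p' =>
    rename_i w
    have hw : w ∈ S := hS w hadj
    rw [hSeq] at hw
    exact hp w (by simp) hw

end Summit.CriticalPhenomena.SAWScalingLimit.Theorems.FKGToTraversalBound.Negative
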